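import Summits.ResolutionOfSingularities.ResolutionOfSingularities.Theses.WeightedInvariant
import Summits.ResolutionOfSingularities.ResolutionOfSingularities.Theorems.WeightedInvariantHypersurfaceAdmissibleSequences
import Summits.ResolutionOfSingularities.ResolutionOfSingularities.Theorems.WeightedInvariantHypersurfaceDatumToChoice
import HarnessLib

/-!
# The door `HypersurfaceCentreConstruction` ⟺ the ∃-form: every singular hypersurface pair is admissibly resolvable

Route `ResolutionOfSingularities/WeightedInvariant`, crux `Theses.WeightedInvariant.HypersurfaceCentreConstruction`
(stmt-ResolutionOfSingularities-19897), door line `local-engine`; CRUX-PLAN r1 §v6.2 (`res-L1-w43-plan-1`) and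
`res-L1-w43-tri-2` TRIAGE v3 O-v3.2 (TN-∃).  The converse of
`Theorems/…HypersurfaceAdmissibleSequences.lean` (∃-form ⇒ datum): **a hypersurface terminating centre
datum RESOLVES every hypersurface pair by a finite admissible centre sequence**
(`HypersurfaceTerminatingCentreDatum.resolvable`) — induction on the rank (`rank_induction`); at a singular
pair the datum's own centre is admissible (`isAdmissibleCentre_centre`: `(iii-a)`, `(iii-b′)` through `(ii)`,
`(hom)`), the Rees filtration of its pieces exists (pieces of a regular weighted centre are antitone,
`antitone_piece`), the successor along it is again a hypersurface pair by the tree's tower facts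
(`WeightedThesis.GlobalCobordantPlus.smooth_πPlus_comp_of_isRegularWeightedCentre`,
`WeightedThesis.HypersurfacePreserved.isLocallyPrincipal_strictTransformPlus`,
`DatumToEmbedded.StrictTransform.isIntegral_strictTransformPlus_of_not_mem_support` with the generic point
off the centre, `genericPoint_not_mem_support_centre_of_not_isRegular`), and has smaller rank (`(term)`).

Hence tri-2's TN-∃ as KERNEL theorems: `nonempty_hypersurfaceTerminatingCentreDatum_iff_forall_resolvable`
(prime by prime) and `hypersurfaceCentreConstruction_iff_forall_resolvable` — the door item BY NAME is
equivalent to «over every perfect field of characteristic `p`, every singular hypersurface pair admits a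
finite sequence of centres, each `(iii-a)(iii-b′)(hom)`-admissible on the current pair, whose iterated
`B₊`-successors end in a regular strict transform».  The door owes no invariant, no rank, no canonicity.
Nothing here is a claim about Hironaka's problem; both sides stay open.
-/

noncomputable section

open CategoryTheory AlgebraicGeometry TopologicalSpace
open Literature.AlgebraicGeometry.Resolution
open Summit.ResolutionOfSingularities.ResolutionOfSingularities.Theses.WeightedInvariant

set_option linter.dupNamespace false -- mandated namespace of this single-conjunct summit

namespace Summit.ResolutionOfSingularities.ResolutionOfSingularities.Theorems

namespace HypersurfaceTerminatingCentreDatum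

variable {p : ℕ}

/-- **The centre of a datum at a singular hypersurface pair is an admissible centre** (`(iii-a)`;
`(iii-b′)` read through `(ii)`: the non-minimal locus of the rating is `singImage X` — cf.
`HypersurfaceTerminatingCentreDatum.support_centre_subset_singImage` in
`Theorems/…HypersurfaceCentreConstructionViaChoice.lean`, re-derived here in two lines to keep this file out
of that module's import cone; `(hom)`). [folklore] -/
theorem isAdmissibleCentre_centre (E : HypersurfaceTerminatingCentreDatum p) {k : Type} [Field k]
    [CharP k p] [PerfectField k] {Y : Scheme.{0}}
    (f : Y ⟶ Spec (.of k)) [Smooth f] [IsSeparated f] [QuasiCompact f] (X : Y.IdealSheafData)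
    (hX : IsLocallyPrincipal X) (hXi : IsIntegral X.subscheme) (hsing : ¬ Scheme.IsRegular X.subscheme) :
    IsAdmissibleCentre f X (E.centre f X) := by
  have hguard := E.exists_not_isBot_inv_of_not_isRegular f X hX hXi hsing
  refine ⟨E.isRegularWeightedCentre_centre f X hX hXi hguard, fun y hy => ?_,
    fun j W 𝒜 _ h0 hXhom n => E.centre_isHomogeneous f X hX hXi hguard j W 𝒜 h0 hXhom n⟩
  have hy' : ¬ IsBot (E.inv f X y) := E.support_centre_subset f X hX hXi hguard hy
  rw [E.isBot_inv_iff f X hX hXi y] at hy'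
  simp only [singImage, Set.mem_setOf_eq]
  push Not at hy'
  exact hy'

/-- **A hypersurface terminating centre datum resolves every hypersurface pair over a perfect field of
characteristic `p` by a finite admissible centre sequence** (tri-2 TN-∃, direction ⇒): induction on the
rank; a regular pair is resolved in `0` steps; at a singular pair the datum's centre is admissible, the
successor along the Rees filtration of its pieces is again a hypersurface pair (tower facts of the tree) of
smaller rank (`(term)`), resolvable by induction. [folklore] -/
theorem resolvable_ofIs (E : HypersurfaceTerminatingCentreDatum p) {k : Type} [Field k] [CharP k p]
    [PerfectField k] {Y : Scheme.{0}}
    (f : Y ⟶ Spec (.of k)) (X : Y.IdealSheafData) (h : IsHypersurfacePair f X) :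
    (HypersurfacePair.ofIs f X h).Resolvable := by
  haveI := h.1; haveI := h.2.1; haveI := h.2.2.1
  have key := E.rank_induction
    (fun (Y : Scheme.{0}) (f : Y ⟶ Spec (.of k)) (I : Y.IdealSheafData) =>
      ∀ h : IsHypersurfacePair f I, (HypersurfacePair.ofIs f I h).Resolvable) ?base ?step Y f X
      h.2.2.2.1 h.2.2.2.2
  · exact key h
  · -- base: `inv` everywhere minimal ⇒ `V(I)` regular ⇒ resolved in `0` steps
    intro Y f _ _ _ I hI hIi hbot h
    exact ⟨0, (HypersurfacePair.admissiblyResolvable_zero_iff _).mpr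
      ((E.forall_isBot_inv_iff f I hI hIi).mp hbot)⟩
  · -- step
    intro Y f _ _ _ I hI hIi hguard ih h
    haveI : IsLocallyNoetherian Y := LocallyOfFiniteType.isLocallyNoetherian f
    haveI : IsIntegral I.subscheme := hIi
    have hY : Scheme.IsRegular Y := Scheme.IsRegular.of_smooth f (Scheme.isRegular_Spec (.of k))
    by_cases hreg : Scheme.IsRegular I.subscheme
    · exact ⟨0, (HypersurfacePair.admissiblyResolvable_zero_iff _).mpr hreg⟩
    -- the centre and the Rees filtration of its pieces
    have hc : (E.centre f I).IsRegularWeightedCentre := E.isRegularWeightedCentre_centre f I hI hIi hguard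
    let R' : ReesFiltration Y :=
      { ideal := (E.centre f I).piece
        ideal_zero := (E.centre f I).piece_zero
        antitone := antitone_piece hc
        mul_le := (E.centre f I).piece_mul_le }
    -- the successor is a hypersurface pair
    obtain ⟨hs, hsep, hqc⟩ :=
      WeightedThesis.GlobalCobordantPlus.smooth_πPlus_comp_of_isRegularWeightedCentre f (E.centre f I)
        hc R' rfl
    have hlp' : IsLocallyPrincipal (R'.strictTransformPlus I) :=
      WeightedThesis.HypersurfacePreserved.isLocallyPrincipal_strictTransformPlus hY (E.centre f I) hc
        R' rfl I hI
    have hξ : I.subschemeι (genericPoint I.subscheme) ∉ (E.centre f I).support := by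
      have hker : IsLocallyPrincipal I.subschemeι.ker := by
        rw [Scheme.IdealSheafData.ker_subschemeι]; exact hI
      have h' := E.genericPoint_not_mem_support_centre_of_not_isRegular f I.subschemeι hker hreg
      rwa [Scheme.IdealSheafData.ker_subschemeι] at h'
    have hint' : IsIntegral (R'.strictTransformPlus I).subscheme := by
      have h' := (DatumToEmbedded.StrictTransform.isIntegral_strictTransformPlus_of_not_mem_support
        I.subschemeι (E.centre f I) hc R' rfl hξ).1
      rwa [Scheme.IdealSheafData.ker_subschemeι] at h'
    -- the rank drops and the induction hypothesis resolves the successor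
    have hdrop : E.rank (R'.πPlus ≫ f) (R'.strictTransformPlus I) < E.rank f I :=
      E.rank_lt f I hI hIi hguard R' rfl
    haveI := hs; haveI := hsep; haveI := hqc
    obtain ⟨n, hn⟩ := ih (R'.plus : Scheme.{0}) (R'.πPlus ≫ f) (R'.strictTransformPlus I) hlp' hint'
      hdrop ⟨hs, hsep, hqc, hlp', hint'⟩
    refine ⟨n + 1, (HypersurfacePair.admissiblyResolvable_succ_iff _ n).mpr ⟨E.centre f I, ?_⟩⟩
    exact ⟨E.isAdmissibleCentre_centre f I hI hIi hreg, R', rfl, hs, hsep, hqc, hlp', hint', hn⟩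

/-- **A hypersurface terminating centre datum resolves every hypersurface pair by a finite admissible
centre sequence.** [folklore] -/
theorem resolvable (E : HypersurfaceTerminatingCentreDatum p) {k : Type} [Field k] [CharP k p]
    [PerfectField k] (P : HypersurfacePair k) : P.Resolvable :=
  E.resolvable_ofIs P.f P.X ⟨P.smooth, P.isSeparated, P.quasiCompact, P.isLocallyPrincipal, P.isIntegral⟩

end HypersurfaceTerminatingCentreDatum

/-- **TN-∃ as a kernel theorem, prime by prime: a hypersurface terminating centre datum in characteristic
`p` exists iff over every perfect field of characteristic `p` every SINGULAR hypersurface pair admits a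
finite admissible centre sequence ending in a regular strict transform** (⇐
`HypersurfaceTerminatingCentreDatum.ofFiniteSequences`; ⇒ `HypersurfaceTerminatingCentreDatum.resolvable`).
[folklore] -/
theorem nonempty_hypersurfaceTerminatingCentreDatum_iff_forall_resolvable (p : ℕ) :
    Nonempty (HypersurfaceTerminatingCentreDatum p) ↔
      ∀ ⦃k : Type⦄ [Field k] [CharP k p] [PerfectField k] (P : HypersurfacePair k),
        ¬ Scheme.IsRegular P.X.subscheme → P.Resolvable :=
  ⟨fun ⟨E⟩ _ _ _ _ P _ => E.resolvable P,
    fun h => nonempty_hypersurfaceTerminatingCentreDatum_of_finiteSequences p h⟩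

/-- The same with the hypothesis on ALL hypersurface pairs (regular ones are resolved in `0` steps).
[folklore] -/
theorem nonempty_hypersurfaceTerminatingCentreDatum_iff_forall_resolvable' (p : ℕ) :
    Nonempty (HypersurfaceTerminatingCentreDatum p) ↔
      ∀ ⦃k : Type⦄ [Field k] [CharP k p] [PerfectField k] (P : HypersurfacePair k), P.Resolvable :=
  ⟨fun ⟨E⟩ _ _ _ _ P => E.resolvable P,
    fun h => nonempty_hypersurfaceTerminatingCentreDatum_of_finiteSequences p fun _ _ _ _ P _ => h P⟩

/-- **The door `HypersurfaceCentreConstruction` (stmt-19897) is EQUIVALENT to the ∃-form**: at every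
prime `p`, over every perfect field of characteristic `p`, every singular hypersurface pair admits a
finite sequence of centres, each `(iii-a)(iii-b′)(hom)`-admissible on the current pair, whose iterated
`B₊`-successors end in a regular strict transform (tri-2 TRIAGE v3 O-v3.2, now kernel-checked). [folklore] -/
theorem hypersurfaceCentreConstruction_iff_forall_resolvable :
    HypersurfaceCentreConstruction ↔
      ∀ p : ℕ, p.Prime → ∀ ⦃k : Type⦄ [Field k] [CharP k p] [PerfectField k] (P : HypersurfacePair k),
        ¬ Scheme.IsRegular P.X.subscheme → P.Resolvable :=
  ⟨fun h p hp => (nonempty_hypersurfaceTerminatingCentreDatum_iff_forall_resolvable p).mp (h p hp),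
    fun h p hp => (nonempty_hypersurfaceTerminatingCentreDatum_iff_forall_resolvable p).mpr (h p hp)⟩

end Summit.ResolutionOfSingularities.ResolutionOfSingularities.Theorems

end
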